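import Literature.Analysis.FluidPDE.ChaeWolfRemovingDSSBounds
import Literature.Analysis.FluidPDE.KNSSProp41OfLocal
import Literature.Analysis.FluidPDE.SelfSimilar
import HarnessLib

/-!
# Crux `FrequencyRigidity` (stmt-NavierStokesRegularity-2955), line `two-ended-pinning`:
# stub `stub_unitTimeDerivBounds` — KNSS window bound at the unit time, all orders

Helper file (lands `--supports stmt-NavierStokesRegularity-2955`; theorems only, no definitions, no
named facts) proving the registered stub `stub_unitTimeDerivBounds` of the line's skeleton: for every
Type-I constant `C` there are constants `C'_k` such that EVERY classical Navier–Stokes flow `(u, p)`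
with viscosity `1` and zero force on `ℝ³ × (−∞, 0)` obeying the GLOBAL time-Type-I bound
`‖u(t, x)‖ ≤ C/√(−t)` (`HasTypeITimeDecay C u`) satisfies `‖Dᵏu(−1, ·)(x)‖ ≤ C'_k` for all `k ≥ 1`
and all `x` (constants uniform over the Type-I class — the neighbouring stub transfers them to every
`t < 0` and every viscosity by rescaling).

Proof (the `k = 1` pattern of the tree's `ChaeWolf.exists_uniform_lipschitz`, run at every order):
on the window `t ∈ (−3, −7/8)` the flow is bounded by `3 max(C, 0)` (`√(−t) ≥ 1/3`), hence — after
the time translation `τ = t + 3 ∈ (0, 17/8)` (`IsBoundedWeakNSSolutionOn.comp_add_right`) — a bounded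
weak solution there (`IsClassicalNSSolutionOn.isBoundedWeakNSSolutionOn`); the PROVED tree theorem
`KNSS2009_regularity_boundedWeak_window_holds` (KNSS 2009 §4, (4.10)) gives `u = U + b(τ)` a.e. with
`‖DᵏU(τ, ·)‖ ≤ C(k, δ)` on `(δ, 17/8)`; at the good times the slices agree everywhere (continuity,
`Continuous.ae_eq_iff_eq`) and derivatives of order `≥ 1` do not see the drift `b(τ)`, so
`‖Dᵏu‖ ≤ C(k, 1)` at a.e. `τ ∈ (1, 17/8)`; continuity of `τ ↦ Dᵏu(τ, ·)(x)`
(`IsSmoothSpaceTimeOn.hasDerivAt_iteratedFDeriv_slice`) and `ChaeWolf.le_of_ae_le_of_continuousOn`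
upgrade this to every `τ`, in particular `τ = 2`, i.e. `t = −1`.

## References

* G. Koch, N. Nadirashvili, G. Seregin, V. Šverák, *Liouville theorems for the Navier–Stokes equations
  and applications*, Acta Math. 203 (2009) 83–105 = arXiv:0709.3599, §4 (4.10) and proof of Thm. 5.2,
  first sentence. [KochNadirashviliSereginSverak2009]
* D. Chae, J. Wolf, Comm. PDE 42 (2017) = arXiv:1610.09464, §3 (3.6)–(3.7). [ChaeWolf2017RemovingDSS]
-/

noncomputable section

namespace Summit.NavierStokesRegularity.NavierStokesRegularity.Theorems.FrequencyRigidity.TwoEndedPinning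

open Literature.Analysis.FluidPDE MeasureTheory Set Filter Topology Function
open scoped ContDiff

/-- Derivatives of order `k ≥ 1` do not see an additive constant: `Dᵏ(f + c) = Dᵏf` (no
differentiability needed: `Dᵏ⁺¹g` is the curried `Dᵏ(Dg)` and `D(f + c) = Df`). [folklore] -/
private theorem iteratedFDeriv_add_const_of_one_le {X F : Type*} [NormedAddCommGroup X]
    [NormedSpace ℝ X] [NormedAddCommGroup F] [NormedSpace ℝ F] (f : X → F) (c : F) {k : ℕ}
    (hk : 1 ≤ k) (x : X) :
    iteratedFDeriv ℝ k (fun y => f y + c) x = iteratedFDeriv ℝ k f x := by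
  obtain ⟨n, rfl⟩ : ∃ n, k = n + 1 := ⟨k - 1, by omega⟩
  rw [iteratedFDeriv_succ_eq_comp_right (f := fun y => f y + c),
    iteratedFDeriv_succ_eq_comp_right (f := f)]
  simp only [Function.comp_apply, fderiv_add_const]

/-- Type I decay in time ⟹ `‖u(t, x)‖ ≤ 3 max(C, 0)` for `t < −7/8` (`√(−t) ≥ 1/3`). [folklore] -/
private theorem typeITime_norm_le_three_mul_max {C : ℝ}
    {u : ℝ → EuclideanSpace ℝ (Fin 3) → EuclideanSpace ℝ (Fin 3)} (hI : HasTypeITimeDecay C u)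
    {t : ℝ} (ht : t < -(7 / 8 : ℝ)) (y : EuclideanSpace ℝ (Fin 3)) :
    ‖u t y‖ ≤ 3 * max C 0 := by
  have hM0 : 0 ≤ max C 0 := le_max_right _ _
  have hst : 0 < Real.sqrt (-t) := Real.sqrt_pos.2 (by linarith)
  have h13 : (1 / 3 : ℝ) ≤ Real.sqrt (-t) := (Real.le_sqrt' (by norm_num)).2 (by nlinarith)
  calc ‖u t y‖ ≤ C / Real.sqrt (-t) := hI t (by linarith) y
    _ ≤ max C 0 / Real.sqrt (-t) := div_le_div_of_nonneg_right (le_max_left _ _) hst.le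
    _ ≤ max C 0 / (1 / 3) := div_le_div_of_nonneg_left hM0 (by norm_num) h13
    _ = 3 * max C 0 := by ring

/-- **Stub 1a of the line `two-ended-pinning` — KNSS window bound at the unit time, all orders.**
For every Type-I constant `C` there are constants `C'_k` such that every classical Navier–Stokes flow
`(u, p)` with viscosity `1` on `ℝ³ × (−∞, 0)` with the GLOBAL time-Type-I bound `‖u(t,x)‖ ≤ C/√(−t)`
obeys `‖Dᵏu(−1, x)‖ ≤ C'_k` for all `k ≥ 1` and all `x`: on the window `(−3, −7/8)` the flow is a
bounded (by `3 max(C,0)`) weak solution, KNSS 2009 §4 (4.10)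
(`KNSS2009_regularity_boundedWeak_window_holds`) bounds `DᵏU` for the smooth part of `u = U + b(τ)`,
derivatives of order `≥ 1` ignore the drift, and continuity in `τ` removes the exceptional times.
[cite: KochNadirashviliSereginSverak2009, §4 (4.10) and proof of Thm 5.2 first sentence] -/
theorem stub_unitTimeDerivBounds :
    ∀ C : ℝ, ∃ C' : ℕ → ℝ,
      ∀ (u : ℝ → EuclideanSpace ℝ (Fin 3) → EuclideanSpace ℝ (Fin 3))
        (p : ℝ → EuclideanSpace ℝ (Fin 3) → ℝ),
        Literature.Analysis.FluidPDE.IsClassicalNSSolutionOn (Set.Iio 0) 1 0 u p →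
        Literature.Analysis.FluidPDE.HasTypeITimeDecay C u →
        ∀ k : ℕ, 1 ≤ k → ∀ x : EuclideanSpace ℝ (Fin 3),
          ‖iteratedFDeriv ℝ k (u (-1)) x‖ ≤ C' k := by
  intro C
  -- the KNSS window package on `(0, 17/8)` for the bound `M = 3 max(C, 0)`
  obtain ⟨Cw, Lw, N, hwin⟩ :=
    KNSS2009_regularity_boundedWeak_window_holds (3 * max C 0) (17 / 8) (by norm_num)
  refine ⟨fun k => Cw k 1, fun u p hcl hI k hk x => ?_⟩
  -- the window based at `a = -3`: `τ = t - a ∈ (0, 17/8)` ↔ `t ∈ (-3, -7/8)`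
  set a : ℝ := -3 with ha
  set w : ℝ → EuclideanSpace ℝ (Fin 3) → EuclideanSpace ℝ (Fin 3) := fun τ => u (τ + a) with hw
  have hIoo : Ioo a (a + 17 / 8) ⊆ Iio 0 := fun τ hτ => by
    simp only [mem_Iio]; linarith [hτ.2]
  have hneg : ∀ τ ∈ Ioo (0 : ℝ) (17 / 8), τ + a < -(7 / 8 : ℝ) := fun τ hτ => by
    rw [ha]; linarith [hτ.2]
  have hcl' : IsClassicalNSSolutionOn (Ioo a (a + 17 / 8)) 1 0 u p :=
    hcl.mono hIoo (uniqueDiffOn_Ioo _ _)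
  have hbdd : IsBoundedOn (Ioo a (a + 17 / 8)) u :=
    ⟨3 * max C 0, fun τ hτ y =>
      typeITime_norm_le_three_mul_max hI (by rw [ha] at hτ; linarith [hτ.2]) y⟩
  have hweak : IsBoundedWeakNSSolutionOn (Ioo 0 (17 / 8)) isOpen_Ioo 1 w :=
    (hcl'.isBoundedWeakNSSolutionOn hbdd).comp_add_right a (J := Ioo 0 (17 / 8)) isOpen_Ioo
      fun τ => by
        simp only [mem_Ioo]
        constructor <;> intro h <;> constructor <;> linarith [h.1, h.2]
  have hM : ∀ τ ∈ Ioo (0 : ℝ) (17 / 8), ∀ y, ‖w τ y‖ ≤ 3 * max C 0 := fun τ hτ y =>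
    typeITime_norm_le_three_mul_max hI (hneg τ hτ) y
  obtain ⟨U, b, -, -, -, hae, hUs, -, hUC, -, -⟩ := hwin hweak hM
  -- joint smoothness of the translated flow on the window
  have hws : IsSmoothSpaceTimeOn (Ioo 0 (17 / 8)) w := by
    have h1 := hcl.smooth_velocity.comp_add_right a
    refine h1.mono fun τ hτ => ?_
    simp only [mem_preimage, mem_Iio]
    linarith [hneg τ hτ]
  have hwx : ∀ τ ∈ Ioo (0 : ℝ) (17 / 8), Continuous (w τ) := fun τ hτ =>
    (hws.contDiff_slice hτ).continuous
  have hsub1 : Ioo (1 : ℝ) (17 / 8) ⊆ Ioo 0 (17 / 8) := Ioo_subset_Ioo_left zero_le_one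
  -- good times: the a.e. identity holds everywhere in `x`
  have hgood : ∀ᵐ τ ∂((volume : Measure ℝ).restrict (Ioo 0 (17 / 8))),
      τ ∈ Ioo (0 : ℝ) (17 / 8) ∧ ∀ y, w τ y = U τ y + b τ := by
    filter_upwards [hae, ae_restrict_mem measurableSet_Ioo] with τ hτ hτm
    refine ⟨hτm, fun y => ?_⟩
    have hc2 : Continuous fun y => U τ y + b τ := (hUs τ hτm).continuous.add continuous_const
    exact congr_fun ((Continuous.ae_eq_iff_eq volume (hwx τ hτm) hc2).1 hτ) y
  have hgood1 : ∀ᵐ τ ∂((volume : Measure ℝ).restrict (Ioo 1 (17 / 8))),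
      τ ∈ Ioo (0 : ℝ) (17 / 8) ∧ ∀ y, w τ y = U τ y + b τ :=
    ae_restrict_of_ae_restrict_of_subset hsub1 hgood
  -- continuity of `τ ↦ ‖Dᵏw(τ, ·)(x)‖` on the window (exchange of `∂ₜ` with `∇ᵏₓ`)
  have hcont : ContinuousOn (fun τ => ‖iteratedFDeriv ℝ k (w τ) x‖) (Ioo 1 (17 / 8)) := by
    refine ContinuousOn.norm fun τ hτ => ?_
    exact (hws.hasDerivAt_iteratedFDeriv_slice isOpen_Ioo k (hsub1 hτ)
      x).continuousAt.continuousWithinAt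
  -- the bound at a.e. time, upgraded to every time of `(1, 17/8)`
  have hall : ∀ τ ∈ Ioo (1 : ℝ) (17 / 8), ‖iteratedFDeriv ℝ k (w τ) x‖ ≤ Cw k 1 := by
    refine ChaeWolf.le_of_ae_le_of_continuousOn hcont ?_
    filter_upwards [hgood1, ae_restrict_mem measurableSet_Ioo] with τ hτ hτ1
    have heq : w τ = fun y => U τ y + b τ := funext hτ.2
    rw [heq, iteratedFDeriv_add_const_of_one_le _ _ hk]
    exact hUC 1 one_pos k τ hτ1 x
  -- read off `τ = 2`, i.e. `t = -1`
  have h2 : (2 : ℝ) ∈ Ioo (1 : ℝ) (17 / 8) := ⟨by norm_num, by norm_num⟩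
  have e2 : w 2 = u (-1) := by
    simp only [hw, ha]
    congr 1
    norm_num
  have key := hall 2 h2
  rwa [e2] at key

end Summit.NavierStokesRegularity.NavierStokesRegularity.Theorems.FrequencyRigidity.TwoEndedPinning

end
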